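import Literature.NumberTheory.Sieve.BatemanHorn
import HarnessLib

/-!
# The linear Bateman–Horn system `(X + h)_{h ∈ H}`: `ω_f(p) = ν_H(p)` and admissibility

Topic `Literature/NumberTheory/Sieve`, proofs-only companion of `BatemanHorn.lean` (kept separate
so that the definitions file is untouched; the existing companion `BatemanHornProofs.lean` carries
the heavy imports of the convergence proof, which are not needed here). It DISCHARGES two named
facts of `BatemanHorn.lean`:

* `Literature.NumberTheory.Sieve.polyRootCountMod_linear_eq_tupleResidueCount` — for the linear
  system `f_h = X + h` (`h ∈ H`) and a prime `p`, `ω_f(p) = ν_H(p)`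
  (`polyRootCountMod_linear_eq_tupleResidueCount_holds`);
* `Literature.NumberTheory.Sieve.hasNoFixedPrimeDivisor_linear_iff` — the linear system has no
  fixed prime divisor iff `H` is admissible (`hasNoFixedPrimeDivisor_linear_iff_holds`).

## Proof

For `n : ℕ`, `p ∣ ∏_h (n + h)` iff `n + h ≡ 0 (mod p)` for some `h ∈ H` (Euclid's lemma), i.e.
iff `-(n mod p) ∈ H mod p`. Hence `n ↦ -(n mod p)` is a bijection from
`{n < p : p ∣ ∏_h f_h(n)}` onto the image of `H` in `ℤ/pℤ`, with inverse `x ↦ (-x).val`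
(`Finset.card_bij'`), so `ω_f(p) = ν_H(p)`; the equivalence of "no fixed prime divisor"
(`ω_f(p) < p` for all `p`) with admissibility (`ν_H(p) < p` for all `p`) follows at once. This is
the remark in Crandall–Pomerance, *Prime Numbers: A Computational Perspective*, §1.2.2 (the
hypothesis of the prime `k`-tuples conjecture: "for each prime `p` there is some `n` with no
`aᵢ n + bᵢ` divisible by `p`"), and Halberstam–Richert, *Sieve Methods*, ch. 10. The proofs are
elementary and use only the light imports of `BatemanHorn.lean` (Euclid's lemma is routed through
`Int.natAbs` and `Nat.Prime.dvd_mul`).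

## References

* P. T. Bateman, R. A. Horn, *A heuristic asymptotic formula concerning the distribution of prime
  numbers*, Math. Comp. 16 (1962), 363–367, §3.
* R. Crandall, C. Pomerance, *Prime Numbers: A Computational Perspective*, Springer, §1.2.2.
* H. Halberstam, H.-E. Richert, *Sieve Methods*, Academic Press 1974, ch. 10.
-/

noncomputable section

open Finset Polynomial

namespace Literature.NumberTheory.Sieve

/-- Euclid's lemma for a rational prime `p` and a finite product of integers:
`p ∣ ∏_{i ∈ s} g i` iff `p ∣ g i` for some `i ∈ s`. [folklore] -/
theorem natCast_dvd_prod_int_iff {α : Type*} {p : ℕ} (hp : p.Prime) (s : Finset α)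
    (g : α → ℤ) : (p : ℤ) ∣ ∏ i ∈ s, g i ↔ ∃ i ∈ s, (p : ℤ) ∣ g i := by
  refine ⟨fun h ↦ ?_, fun ⟨i, hi, h⟩ ↦ h.trans (Finset.dvd_prod_of_mem g hi)⟩
  by_contra hne
  refine Finset.prod_induction g (fun z ↦ ¬(p : ℤ) ∣ z) ?_ ?_ (fun i hi hpi ↦ hne ⟨i, hi, hpi⟩) h
  · intro a b ha hb hab
    rw [Int.natCast_dvd, Int.natAbs_mul, hp.dvd_mul] at hab
    exact hab.elim (fun h' ↦ ha (Int.natCast_dvd.mpr h')) (fun h' ↦ hb (Int.natCast_dvd.mpr h'))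
  · rw [Int.natCast_dvd, Int.natAbs_one, Nat.dvd_one]
    exact hp.ne_one

/-- For the linear system `f_h = X + h` (`h ∈ H`), a prime `p` and `n : ℕ`:
`p ∣ ∏_h f_h(n)` iff `n + h ≡ 0 (mod p)` for some `h ∈ H`. [folklore] -/
theorem prime_dvd_prod_eval_linear_iff (H : Finset ℤ) {p : ℕ} (hp : p.Prime) (n : ℕ) :
    (p : ℤ) ∣ ∏ i : H, ((X + C (i : ℤ) : ℤ[X])).eval (n : ℤ) ↔
      ∃ h ∈ H, (n : ZMod p) + ((h : ℤ) : ZMod p) = 0 := by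
  rw [natCast_dvd_prod_int_iff hp]
  simp only [eval_add, eval_X, eval_C, Finset.mem_univ, true_and,
    ← ZMod.intCast_zmod_eq_zero_iff_dvd, Int.cast_add, Int.cast_natCast, Subtype.exists,
    exists_prop]

/-- Discharge of `polyRootCountMod_linear_eq_tupleResidueCount`: for the linear system
`f_h = X + h` (`h ∈ H`) and a prime `p`, `ω_f(p) = ν_H(p)`. The residues `n mod p` with
`p ∣ ∏_h (n + h)` are exactly the classes `-h mod p`, `h ∈ H`, and `x ↦ -x` is a bijection of
`ℤ/pℤ` (`Finset.card_bij'` with inverse `x ↦ (-x).val`). Bateman–Horn 1962, §3;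
Crandall–Pomerance, *Prime Numbers*, §1.2.2; Halberstam–Richert ch. 10.
[cite: BatemanHorn1962, §3] -/
theorem polyRootCountMod_linear_eq_tupleResidueCount_holds :
    polyRootCountMod_linear_eq_tupleResidueCount := by
  intro H p hp
  haveI : NeZero p := ⟨hp.ne_zero⟩
  unfold polyRootCountMod tupleResidueCount
  refine Finset.card_bij' (fun n _ ↦ -((n : ℕ) : ZMod p)) (fun x _ ↦ (-x).val) ?_ ?_ ?_ ?_
  · intro n hn
    rw [Finset.mem_filter] at hn
    obtain ⟨h, hh, h0⟩ := (prime_dvd_prod_eval_linear_iff H hp n).mp hn.2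
    exact Finset.mem_image.mpr ⟨h, hh, eq_neg_iff_add_eq_zero.mpr ((add_comm _ _).trans h0)⟩
  · intro x hx
    obtain ⟨h, hh, rfl⟩ := Finset.mem_image.mp hx
    rw [Finset.mem_filter, Finset.mem_range]
    refine ⟨ZMod.val_lt _, (prime_dvd_prod_eval_linear_iff H hp _).mpr ⟨h, hh, ?_⟩⟩
    rw [ZMod.natCast_zmod_val, neg_add_cancel]
  · intro n hn
    rw [Finset.mem_filter, Finset.mem_range] at hn
    simp only [neg_neg]
    exact ZMod.val_natCast_of_lt hn.1
  · intro x _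
    simp only [ZMod.natCast_zmod_val, neg_neg]

/-- Discharge of `hasNoFixedPrimeDivisor_linear_iff`: the linear system `(X + h)_{h ∈ H}` has no
fixed prime divisor iff `H` is admissible, since `ω_f(p) = ν_H(p)` for every prime `p`
(`polyRootCountMod_linear_eq_tupleResidueCount_holds`). Crandall–Pomerance, *Prime Numbers*,
§1.2.2; Halberstam–Richert, *Sieve Methods*, ch. 10. [folklore] -/
theorem hasNoFixedPrimeDivisor_linear_iff_holds : hasNoFixedPrimeDivisor_linear_iff := by
  intro H
  simp only [HasNoFixedPrimeDivisor, IsAdmissibleTuple]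
  refine forall₂_congr fun p hp ↦ ?_
  rw [polyRootCountMod_linear_eq_tupleResidueCount_holds H hp]

end Literature.NumberTheory.Sieve

end
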